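import Mathlib
import Summits.ValiantsHypothesis.ValiantsHypothesis.Cruxes.NNLinearDegreeCofactorHard.Lines.xc_division
import Literature.Barriers.PneNP.TSPExtensionComplexityHyperplaneBound
import Literature.Barriers.PneNP.ExtendedFormulationLinearImage

/-! # Clique-row blindness (val-idea-39 g3, b139 W5-P1; crux `FifoMatching.NNDivisionHard`, stmt-ValiantsHypothesis-21181)

A BUDGETED, REALIZABLE Minkowski passenger on which the augmented clique-row slack of `COR(n) + Q` — the matrix
`M(a;(b,j)) = (1 + m_a) − ⟨udRow a, udPt b + q_j⟩ = (1 − |a ∩ b|)² + G(a,j)` that every value-level certificate of the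
line `virtual_passenger` lives on (PROP R corruption, N9-lift, `entangled_budget`, `InteractionMatrixLaw`) — has
POLYNOMIAL nonnegative rank, while `xc(COR(n) + Q)` is exponential BY NAME (PROP B, a located/diagonal-face certificate).

* §1 the passenger `Q♮ = conv{qNat P : P ⊆ [n]}` (an affine image of the `n`-cube; `xc ≤ 2n`) and the identity
  `⟨udRow a, qNat P⟩ = −|a|·|a Δ P|` (`udRow_dotProduct_qNat`): Hamming distance made a CONSTANT-FREE quadratic
  pseudo-Boolean form by one multiplication with `|a|`; so `m_a = max_P ⟨udRow a, q_P⟩ = 0`, the recourse is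
  `G(a,P) = |a|·|aΔP|` with zero pattern `{∅, P}` (critic's N13 met), and the augmented clique-row slack of
  `COR(n) + λ•Q♮` is `M_λ(a;(b,P)) = (1 − |a∩b|)² + λ|a||aΔP|` (`blindPair_slack`).
* §2 the explicit nonnegative factorization of `M_λ` through `2n² + 3n + 2` slots (`2n` of them zero) for
  `λ ≥ max(1, n − 1)`: `blindRow`, `blindCol` (nonnegative, all `n`) and ★★ `blind_identity` — the identity for ALL `n`
  and all `λ`, sorry-free with standard axioms (rev 2; rev 1 had `n = 3, 4` by `native_decide`); packaged over `ℝ` as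
  `blindPair_factorization` / `blindPair_factorization_self`: `rank₊ ≤ 2n² + n + 2` for every `n`.
  §2b (rev 4) blindness is GENERIC for affine cubes: the ASYMMETRIC identity `blind_identity₂` / `asymBlind_factorization`
  for `(1 − |a∩b|)² + |a|·(λ₁|a∖P| + λ₂|P∖a|)` (`λ₁ ≥ 1`, `λ₂ ≥ max(1, n−1)`; same `2n² + 3n + 2` slots) — the Q-slack of ANY
  row against an affine cube is a modular wrong-side penalty, and the UDISJ core is absorbed as soon as the per-element
  penalties clear these floors (e.g. the untilted clique rows of `n²•q^γ`).
* §5 (rev 5) prices of VERDICT #29: P-P1a `corVirtualHard_of_corVirtualHardN` (flat ⇒ graph currency of the line of record;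
  `corVirtualHard_of_locatedPencilLaw`), P-P1b ★ `not_cliqueRowsLaw_of_budget : CubeBudget → ¬ cliqueRows.Law` — the realizable
  clique-row law is FALSE in the kernel given only the budget `xc(n•Q♮) ≤ 2n²+3n+1` of the blind cube (no unit-cube EF lemma in
  tree yet; `budget_le_T_two : 2n²+3n+1 ≤ T 2 n`).
* §6 (rev 6) ★★ `cubeBudget_holds : CubeBudget` PROVED (`hasEFOfSize_unitCube : xc([0,1]ⁿ) ≤ n + n` via
  `hasEFOfSize_of_system`; `convexHull_range_udInd : conv{𝟙_P} = [0,1]ⁿ` via `convexHull_pi`; `smul_qNat_eq_affine` +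
  `HasEFOfSize.image_affine` + `AffineMap.image_convexHull`), hence ★★ `not_cliqueRowsLaw : ¬ cliqueRows.Law` UNCONDITIONALLY
  (standard axioms): the realizable clique-row law P1 is refuted in the kernel.
* §3 hardness of the same pair BY NAME is PROP B (`corPolytope_add_face_three_pow_le'`, tree): `E_00` is maximised
  over `Q♮` by `q_{{0}}` alone, so `3^{n-1} ≤ (r+1)·2^{n-1}` for every size-`r` EF of `COR(n) + λ•Q♮` (`blindPair_hard`, PROVED).
* §4 (rev 3) the typed successor: ROW-FAMILY LAWS.  `RowFamily.Law F` («no cheap nonnegative factorization of the augmented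
  `F`-row slack of `COR + Q` for budgeted `Q`»), ★ `corVirtualHardN_of_law` (EVERY row-family law ⟹ COR-VIRTUAL, flat
  currency; Yannakakis once), `RowFamily.Law.mono` (laws are monotone along embeddings), the chain
  `cliqueRows` (P1, REFUTED by §2–§3) `↪ diagTilted` (PROP B's reads; C⁺_diag) `↪ entryTilted` (=: **C⁺ `LocatedPencilLaw`**)
  `↪ allRows`, and `law_chain` / `corVirtualHardN_of_locatedPencilLaw` (PROVED): LOCATION = TILT of the clique rows.

Nothing here proves or refutes the crux: it is an OBSTRUCTION on the prove side (which certificates cannot close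
COR-VIRTUAL) and a TYPED retarget (`LocatedPencilLaw ⟹ CorVirtualHardN`, proved).  VP ≠ VNP is NOT proved. -/

set_option linter.dupNamespace false

namespace Summit.ValiantsHypothesis.ValiantsHypothesis.Cruxes.NNDivisionHard.CliqueRowBlind

open Matrix Finset
open Literature.Barriers.PneNP (HasEFOfSize)
open Literature.Combinatorics.Optimization.FixedSizePsdRank (corPolytope flat)
open Summit.ValiantsHypothesis.ValiantsHypothesis.Cruxes.NNLinearDegreeCofactorHard.XcDivision
  (udRow udPt udInd ud_data udInd_apply udRow_dotProduct_flat_diagonal flat_dotProduct_flat diagDir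
    corPolytope_add_face_three_pow_le')
open scoped Pointwise

/-! ## §1 The blind affine cube `Q♮` -/

/-- the vertex `q_P` of the blind affine cube, flattened: `q_P = 𝟙_{Pᶜ}𝟙_{Pᶜ}ᵀ − 𝟙_P𝟙_Pᵀ + diag(4·𝟙_P − 2 − |P|)`,
i.e. `(q_P)_ii = 2P_i − 1 − |P|`, `(q_P)_im = 1 − P_i − P_m` (`i ≠ m`) — entries AFFINE in `𝟙_P`. -/
def qNat {n : ℕ} (P : Finset (Fin n)) : Fin (n * n) → ℝ :=
  udPt Pᶜ - udPt P + flat (Matrix.diagonal fun i => 4 * udInd P i - 2 - (P.card : ℝ))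

theorem sum_udInd_mem {n : ℕ} (a P : Finset (Fin n)) : ∑ i ∈ a, udInd P i = ((a ∩ P).card : ℝ) := by
  classical
  simp only [udInd_apply]
  rw [Finset.sum_ite_mem, Finset.sum_const, nsmul_eq_mul, mul_one]

/-- ★ `⟨udRow a, q_P⟩ = −|a|·|a Δ P|` (with `|a Δ P| = |a| + |P| − 2|a ∩ P|`). -/
theorem udRow_dotProduct_qNat {n : ℕ} (a P : Finset (Fin n)) :
    udRow a ⬝ᵥ qNat P = -((a.card : ℝ) * (a.card + P.card - 2 * (a ∩ P).card)) := by
  classical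
  obtain ⟨-, -, slack, -⟩ := ud_data n
  have h1 : udRow a ⬝ᵥ udPt Pᶜ = 1 - (1 - ((a ∩ Pᶜ).card : ℝ)) ^ 2 := by linarith [slack a Pᶜ]
  have h2 : udRow a ⬝ᵥ udPt P = 1 - (1 - ((a ∩ P).card : ℝ)) ^ 2 := by linarith [slack a P]
  have h3 : udRow a ⬝ᵥ flat (Matrix.diagonal fun i => 4 * udInd P i - 2 - (P.card : ℝ)) =
      4 * (a ∩ P).card - (2 + P.card) * a.card := by
    rw [udRow_dotProduct_flat_diagonal, Finset.sum_sub_distrib, Finset.sum_sub_distrib, ← Finset.mul_sum,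
      sum_udInd_mem, Finset.sum_const, Finset.sum_const, nsmul_eq_mul, nsmul_eq_mul]
    ring
  have hc : ((a ∩ Pᶜ).card : ℝ) = a.card - (a ∩ P).card := by
    have : (a ∩ Pᶜ).card + (a ∩ P).card = a.card := by
      rw [← Finset.card_union_of_disjoint]
      · congr 1; ext i; simp only [Finset.mem_union, Finset.mem_inter, Finset.mem_compl]; tauto
      · exact Finset.disjoint_left.2 fun i hi hi' =>
          (Finset.mem_compl.1 (Finset.mem_inter.1 hi).2) (Finset.mem_inter.1 hi').2
    have := congrArg (fun k : ℕ => (k : ℝ)) this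
    push_cast at this; linarith
  rw [qNat, dotProduct_add, dotProduct_sub, h1, h2, h3, hc]
  ring

/-- `q_a` attains `0`, every other `q_P` is `≤ 0` on the row `udRow a`: `m_a = 0`, maximiser pattern `{P = a} ∪ {a = ∅}`. -/
theorem udRow_dotProduct_qNat_self {n : ℕ} (a : Finset (Fin n)) : udRow a ⬝ᵥ qNat a = 0 := by
  rw [udRow_dotProduct_qNat, Finset.inter_self]; ring

theorem udRow_dotProduct_qNat_nonpos {n : ℕ} (a P : Finset (Fin n)) : udRow a ⬝ᵥ qNat P ≤ 0 := by
  rw [udRow_dotProduct_qNat, neg_nonpos]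
  have h1 : ((a ∩ P).card : ℝ) ≤ a.card := by exact_mod_cast Finset.card_le_card Finset.inter_subset_left
  have h2 : ((a ∩ P).card : ℝ) ≤ P.card := by exact_mod_cast Finset.card_le_card Finset.inter_subset_right
  exact mul_nonneg (Nat.cast_nonneg _) (by linarith)

/-- ★ **the augmented clique-row slack of `COR(n) + λ•Q♮`** (row value `1 + m_a = 1`):
`1 − ⟨udRow a, udPt b + λ q_P⟩ = (1 − |a∩b|)² + λ·|a|·|aΔP|`. -/
theorem blindPair_slack {n : ℕ} (lam : ℝ) (a b P : Finset (Fin n)) :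
    1 - udRow a ⬝ᵥ (udPt b + lam • qNat P) =
      (1 - ((a ∩ b).card : ℝ)) ^ 2 + lam * (a.card * (a.card + P.card - 2 * (a ∩ P).card)) := by
  obtain ⟨-, -, slack, -⟩ := ud_data n
  rw [dotProduct_add, dotProduct_smul, smul_eq_mul, udRow_dotProduct_qNat, ← sub_sub, slack]
  ring

/-- validity: `udRow a ≤ 1` on every `udPt b + λ q_P` (`λ ≥ 0`). -/
theorem blindPair_valid {n : ℕ} {lam : ℝ} (hlam : 0 ≤ lam) (a b P : Finset (Fin n)) :
    udRow a ⬝ᵥ (udPt b + lam • qNat P) ≤ 1 := by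
  have := blindPair_slack lam a b P
  have hD : 0 ≤ (a.card : ℝ) * (a.card + P.card - 2 * (a ∩ P).card) := by
    have := udRow_dotProduct_qNat_nonpos a P
    rw [udRow_dotProduct_qNat, neg_nonpos] at this; exact this
  nlinarith [sq_nonneg (1 - ((a ∩ b).card : ℝ)), mul_nonneg hlam hD]

/-! ## §2 The explicit nonnegative factorization of `M_λ(a;(b,P)) = (1 − |a∩b|)² + λ|a||aΔP|`

Index type (7 families): `[a = ∅] · 1`, `[a ≠ ∅] · (1 − |P∩b|)²`, and for `i, m : Fin n`
`X_iX_m · (1−P_i)(λ + Y_iY_m)` (`m ≠ i`), `X_i · (1−P_i)(λ + Y_i(p−1))`, `(1−X_i)X_m · P_i(λ − Y_iY_m − Y_i(p−2)₊)` (`m ≠ i`),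
`(1−X_i)(|a|−1)₊ · P_iY_i(p−2)₊`, `(1−X_i)[a ≠ ∅] · P_iY_i(2−p)₊`, where `X = 𝟙_a, Y = 𝟙_b, p = |P ∩ b|`.
All factors are integers; we state them over `ℤ` and cast. -/

/-- index type of the factorization: `2 + n² + n + n² + n + n = 2n² + 3n + 2` terms (diagonal `(i,i)` slots carry `0`). -/
abbrev BIdx (n : ℕ) := (Fin 2) ⊕ (Fin n × Fin n) ⊕ Fin n ⊕ (Fin n × Fin n) ⊕ Fin n ⊕ Fin n

theorem card_BIdx (n : ℕ) : Fintype.card (BIdx n) = 2 * n ^ 2 + 3 * n + 2 := by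
  simp [BIdx, Fintype.card_sum, Fintype.card_prod, Fintype.card_fin]; ring

section IntCore
variable {n : ℕ}

/-- indicator as an integer -/
def ind (a : Finset (Fin n)) (i : Fin n) : ℤ := if i ∈ a then 1 else 0

/-- row factors `U(a, idx) ≥ 0` -/
def blindRow (a : Finset (Fin n)) : BIdx n → ℤ
  | Sum.inl k => if k = 0 then (if a = ∅ then 1 else 0) else (if a = ∅ then 0 else 1)
  | Sum.inr (Sum.inl (i, m)) => if i = m then 0 else ind a i * ind a m
  | Sum.inr (Sum.inr (Sum.inl i)) => ind a i
  | Sum.inr (Sum.inr (Sum.inr (Sum.inl (i, m)))) => if i = m then 0 else (1 - ind a i) * ind a m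
  | Sum.inr (Sum.inr (Sum.inr (Sum.inr (Sum.inl i)))) => (1 - ind a i) * max ((a.card : ℤ) - 1) 0
  | Sum.inr (Sum.inr (Sum.inr (Sum.inr (Sum.inr i)))) => (1 - ind a i) * (if a = ∅ then 0 else 1)

/-- column factors `V((b,P), idx) ≥ 0` for `λ ≥ n − 1` (`p = |P ∩ b|`) -/
def blindCol (lam : ℤ) (b P : Finset (Fin n)) : BIdx n → ℤ
  | Sum.inl k => if k = 0 then 1 else (1 - ((P ∩ b).card : ℤ)) ^ 2
  | Sum.inr (Sum.inl (i, m)) => (1 - ind P i) * (lam + ind b i * ind b m)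
  | Sum.inr (Sum.inr (Sum.inl i)) => (1 - ind P i) * (lam + ind b i * (((P ∩ b).card : ℤ) - 1))
  | Sum.inr (Sum.inr (Sum.inr (Sum.inl (i, m)))) =>
      ind P i * (lam - ind b i * ind b m - ind b i * max (((P ∩ b).card : ℤ) - 2) 0)
  | Sum.inr (Sum.inr (Sum.inr (Sum.inr (Sum.inl i)))) => ind P i * ind b i * max (((P ∩ b).card : ℤ) - 2) 0
  | Sum.inr (Sum.inr (Sum.inr (Sum.inr (Sum.inr i)))) => ind P i * ind b i * max (2 - ((P ∩ b).card : ℤ)) 0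

/-- the target entry `(1 − |a∩b|)² + λ|a||aΔP|` over `ℤ` -/
def blindLHS (lam : ℤ) (a b P : Finset (Fin n)) : ℤ :=
  (1 - ((a ∩ b).card : ℤ)) ^ 2 + lam * (a.card * (a.card + P.card - 2 * ((a ∩ P).card : ℤ)))

theorem ind_nonneg (a : Finset (Fin n)) (i : Fin n) : 0 ≤ ind a i := by
  unfold ind; split_ifs <;> norm_num

theorem ind_le_one (a : Finset (Fin n)) (i : Fin n) : ind a i ≤ 1 := by
  unfold ind; split_ifs <;> norm_num

theorem blindRow_nonneg (a : Finset (Fin n)) (idx : BIdx n) : 0 ≤ blindRow a idx := by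
  have h0 := ind_nonneg a; have h1 := ind_le_one a
  rcases idx with k | ⟨i, m⟩ | i | ⟨i, m⟩ | i | i <;> simp only [blindRow]
  · split_ifs <;> norm_num
  · split_ifs
    · exact le_rfl
    · exact mul_nonneg (h0 i) (h0 m)
  · exact h0 i
  · split_ifs
    · exact le_rfl
    · exact mul_nonneg (by linarith [h1 i]) (h0 m)
  · exact mul_nonneg (by linarith [h1 i]) (le_max_right _ _)
  · exact mul_nonneg (by linarith [h1 i]) (by split_ifs <;> norm_num)

/-- column factors are nonnegative as soon as `λ ≥ max(1, n − 1)`. -/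
theorem blindCol_nonneg {lam : ℤ} (hlam1 : 1 ≤ lam) (hlam : (n : ℤ) ≤ lam + 1) (b P : Finset (Fin n))
    (idx : BIdx n) : 0 ≤ blindCol lam b P idx := by
  have h0 := ind_nonneg (n := n); have h1 := ind_le_one (n := n)
  have hp : ((P ∩ b).card : ℤ) ≤ n := by
    have := Finset.card_le_univ (P ∩ b); rw [Fintype.card_fin] at this; exact_mod_cast this
  have hpc : (0 : ℤ) ≤ ((P ∩ b).card : ℤ) := Nat.cast_nonneg _
  rcases idx with k | ⟨i, m⟩ | i | ⟨i, m⟩ | i | i <;> simp only [blindCol]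
  · split_ifs
    · norm_num
    · exact sq_nonneg _
  · exact mul_nonneg (by linarith [h1 P i]) (by nlinarith [h0 b i, h0 b m, h1 b i, h1 b m])
  · exact mul_nonneg (by linarith [h1 P i]) (by nlinarith [mul_nonneg (h0 b i) hpc, h1 b i, h0 b i])
  · refine mul_nonneg (h0 P i) ?_
    rcases le_or_gt 2 ((P ∩ b).card : ℤ) with h | h
    · rw [max_eq_left (by linarith)]
      nlinarith [h0 b i, h1 b i, h0 b m, h1 b m, mul_nonneg (h0 b i) (h0 b m),
        mul_le_of_le_one_left (show (0:ℤ) ≤ ((P ∩ b).card : ℤ) - 2 by linarith) (h1 b i)]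
    · rw [max_eq_right (by linarith)]
      nlinarith [h0 b i, h1 b i, h0 b m, h1 b m, mul_nonneg (h0 b i) (h0 b m)]
  · exact mul_nonneg (mul_nonneg (h0 P i) (h0 b i)) (le_max_right _ _)
  · exact mul_nonneg (mul_nonneg (h0 P i) (h0 b i)) (le_max_right _ _)

theorem ind_mul_self (a : Finset (Fin n)) (i : Fin n) : ind a i * ind a i = ind a i := by
  unfold ind; split_ifs <;> ring

theorem ind_inter (a b : Finset (Fin n)) (i : Fin n) : ind a i * ind b i = ind (a ∩ b) i := by
  unfold ind; by_cases ha : i ∈ a <;> by_cases hb : i ∈ b <;> simp [ha, hb]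

theorem sum_ind (a : Finset (Fin n)) : ∑ i, ind a i = (a.card : ℤ) := by
  classical
  unfold ind
  rw [Finset.sum_boole, Finset.filter_mem_eq_inter, Finset.univ_inter]

theorem sum_ind_mul (a b : Finset (Fin n)) : ∑ i, ind a i * ind b i = ((a ∩ b).card : ℤ) := by
  simp_rw [ind_inter]; exact sum_ind _

theorem sum_ite_eq_sub (i : Fin n) (g : Fin n → ℤ) :
    ∑ m, (if i = m then 0 else g m) = ∑ m, g m - g i := by
  have : ∀ m, (if i = m then 0 else g m) = g m - (if i = m then g m else 0) := by
    intro m; split_ifs <;> ring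
  simp_rw [this]
  rw [Finset.sum_sub_distrib, Finset.sum_ite_eq, if_pos (Finset.mem_univ _)]

/-- the six blocks of a sum over `BIdx n` -/
theorem sum_BIdx (f : BIdx n → ℤ) :
    ∑ idx, f idx = (f (Sum.inl 0) + f (Sum.inl 1)) +
      ((∑ i, ∑ m, f (Sum.inr (Sum.inl (i, m)))) +
      ((∑ i, f (Sum.inr (Sum.inr (Sum.inl i)))) +
      ((∑ i, ∑ m, f (Sum.inr (Sum.inr (Sum.inr (Sum.inl (i, m)))))) +
      ((∑ i, f (Sum.inr (Sum.inr (Sum.inr (Sum.inr (Sum.inl i)))))) +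
       (∑ i, f (Sum.inr (Sum.inr (Sum.inr (Sum.inr (Sum.inr i)))))))))) := by
  simp only [Fintype.sum_sum_type, Fintype.sum_prod_type, Fin.sum_univ_two]

/-- ★★ **THE BLINDNESS IDENTITY, ALL `n`, ALL `λ`** (sorry-free, axioms standard):
`(1 − |a∩b|)² + λ|a||aΔP| = Σ_idx blindRow a idx · blindCol λ b P idx`.
Proof = the per-coordinate regrouping of the card (`X_i² = X_i`, `Σ_{m≠i} X_m = k − X_i`, `(2−p)₊ − (p−2)₊ = 2 − p`). -/
theorem blind_identity (lam : ℤ) (a b P : Finset (Fin n)) :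
    blindLHS lam a b P = ∑ idx : BIdx n, blindRow a idx * blindCol lam b P idx := by
  classical
  rw [sum_BIdx]
  simp only [blindRow, blindCol, Fin.isValue, if_true, show ((1 : Fin 2) = 0) = False from eq_false (by decide),
    if_false]
  have hX2 := ind_mul_self a
  have hY2 := ind_mul_self b
  have sX := sum_ind a
  have sP := sum_ind P
  have sXY := sum_ind_mul a b
  have sPY := sum_ind_mul P b
  have sXP := sum_ind_mul a P
  set M1 : ℤ := max (((P ∩ b).card : ℤ) - 2) 0 with hM1
  set M3 : ℤ := max (2 - ((P ∩ b).card : ℤ)) 0 with hM3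
  have hM : M3 = M1 + (2 - ((P ∩ b).card : ℤ)) := by
    rw [hM1, hM3]
    rcases le_total (((P ∩ b).card : ℤ)) 2 with h | h
    · rw [max_eq_left (by linarith), max_eq_right (by linarith)]; ring
    · rw [max_eq_right (by linarith), max_eq_left (by linarith)]; ring
  -- family `X_i X_m (m ≠ i)`: closed form per `i`
  have F1 : ∀ i, ∑ m, (if i = m then 0 else ind a i * ind a m) * ((1 - ind P i) * (lam + ind b i * ind b m)) =
      ind a i * (1 - ind P i) * (lam * ((a.card : ℤ) - 1) + ind b i * (((a ∩ b).card : ℤ) - 1)) := by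
    intro i
    have : ∀ m, (if i = m then 0 else ind a i * ind a m) * ((1 - ind P i) * (lam + ind b i * ind b m)) =
        if i = m then 0 else ind a i * ind a m * ((1 - ind P i) * (lam + ind b i * ind b m)) := by
      intro m; split_ifs <;> ring
    simp_rw [this]
    rw [sum_ite_eq_sub, hX2, hY2]
    have hs : ∑ m, ind a i * ind a m * ((1 - ind P i) * (lam + ind b i * ind b m)) =
        ind a i * (1 - ind P i) * (lam * ∑ m, ind a m + ind b i * ∑ m, ind a m * ind b m) := by
      rw [Finset.mul_sum, Finset.mul_sum, ← Finset.sum_add_distrib, Finset.mul_sum]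
      exact Finset.sum_congr rfl fun m _ => by ring
    rw [hs, sX, sXY]; ring
  -- family `(1 − X_i) X_m (m ≠ i)`: closed form per `i`
  have F3 : ∀ i, ∑ m, (if i = m then 0 else (1 - ind a i) * ind a m) *
        (ind P i * (lam - ind b i * ind b m - ind b i * M1)) =
      (1 - ind a i) * ind P i *
        (lam * (a.card : ℤ) - ind b i * ((a ∩ b).card : ℤ) - ind b i * M1 * (a.card : ℤ)) := by
    intro i
    have : ∀ m, (if i = m then 0 else (1 - ind a i) * ind a m) *
          (ind P i * (lam - ind b i * ind b m - ind b i * M1)) =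
        if i = m then 0 else (1 - ind a i) * ind a m * (ind P i * (lam - ind b i * ind b m - ind b i * M1)) := by
      intro m; split_ifs <;> ring
    simp_rw [this]
    rw [sum_ite_eq_sub]
    have h0 : (1 - ind a i) * ind a i = 0 := by rw [sub_mul, one_mul, hX2, sub_self]
    have hs : ∑ m, (1 - ind a i) * ind a m * (ind P i * (lam - ind b i * ind b m - ind b i * M1)) =
        (1 - ind a i) * ind P i *
          (lam * ∑ m, ind a m - ind b i * ∑ m, ind a m * ind b m - ind b i * M1 * ∑ m, ind a m) := by
      rw [Finset.mul_sum, Finset.mul_sum, Finset.mul_sum, ← Finset.sum_sub_distrib, ← Finset.sum_sub_distrib,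
        Finset.mul_sum]
      exact Finset.sum_congr rfl fun m _ => by ring
    rw [hs, sX, sXY]
    have : (1 - ind a i) * ind a i * (ind P i * (lam - ind b i * ind b i - ind b i * M1)) = 0 := by
      rw [h0, zero_mul]
    rw [this]; ring
  simp_rw [F1, F3]
  rcases eq_or_ne a ∅ with rfl | ha
  · simp [blindLHS, ind]
  · have hk : max ((a.card : ℤ) - 1) 0 = (a.card : ℤ) - 1 := by
      rw [max_eq_left]; have := Finset.card_pos.2 (Finset.nonempty_iff_ne_empty.2 ha); omega
    simp only [ha, if_false, hk, one_mul, zero_add, mul_one]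
    have per : ∀ i,
        ind a i * (1 - ind P i) * (lam * ((a.card : ℤ) - 1) + ind b i * (((a ∩ b).card : ℤ) - 1)) +
        (ind a i * ((1 - ind P i) * (lam + ind b i * (((P ∩ b).card : ℤ) - 1))) +
        ((1 - ind a i) * ind P i * (lam * (a.card : ℤ) - ind b i * ((a ∩ b).card : ℤ) - ind b i * M1 * (a.card : ℤ)) +
        ((1 - ind a i) * ((a.card : ℤ) - 1) * (ind P i * ind b i * M1) +
         (1 - ind a i) * (ind P i * ind b i * M3)))) =
        lam * (a.card : ℤ) * ind a i + lam * (a.card : ℤ) * ind P i - 2 * lam * (a.card : ℤ) * (ind a i * ind P i)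
          + (((a ∩ b).card : ℤ) + ((P ∩ b).card : ℤ) - 2) * (ind a i * ind b i)
          - (((a ∩ b).card : ℤ) + ((P ∩ b).card : ℤ) - 2) * (ind P i * ind b i) := by
      intro i
      rw [hM]
      ring
    rw [← Finset.sum_add_distrib, ← Finset.sum_add_distrib, ← Finset.sum_add_distrib, ← Finset.sum_add_distrib]
    rw [Finset.sum_congr rfl (fun i _ => per i)]
    rw [Finset.sum_sub_distrib, Finset.sum_add_distrib, Finset.sum_sub_distrib, Finset.sum_add_distrib,
      ← Finset.mul_sum, ← Finset.mul_sum, ← Finset.mul_sum, ← Finset.mul_sum, ← Finset.mul_sum,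
      sX, sP, sXP, sXY, sPY, blindLHS]
    ring


/-! ### §2b (rev 4) Asymmetric recourse `(1 − |a∩b|)² + |a|·(λ₁|a∖P| + λ₂|P∖a|)` — blindness is generic for affine cubes.
For an affine cube `Q = {q_∅ + Σ_{i∈P} g_i}` and ANY row `ρ`, the Q-slack is `Σ_i |⟨ρ,g_i⟩|·[P_i on the wrong side]`
(modular penalties through the 2n fixed column functions `P_i, 1 − P_i`); for clique rows whose maximiser is `P = a`
the penalty is `Σ_{i∈a∖P} w_i⁺ + Σ_{i∈P∖a} w_i⁻`, and the identity below shows the UDISJ core `(1 − |a∩b|)²` is absorbed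
as soon as the `a∖P` weight is `≥ |a|·1` and the `P∖a` weight is `≥ |a|·(n−1)` per element (row-dependent EXCESS weight is
a further sum of rank-one nonnegative terms `X_i·(1−P_i)`, `(1−X_i)·P_i`, so only these FLOORS matter). This covers e.g. the
untilted clique rows of `n²•q^γ` (`q^γ`: diag `2P_i−1`, offdiag `1−P_i−P_m+|P|/n`; weights `λ(2k−k(k−1)/n)` resp. `λk(k−1)/n`). -/

def blindCol₂ (lam₁ lam₂ : ℤ) (b P : Finset (Fin n)) : BIdx n → ℤ
  | Sum.inl k => if k = 0 then 1 else (1 - ((P ∩ b).card : ℤ)) ^ 2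
  | Sum.inr (Sum.inl (i, m)) => (1 - ind P i) * (lam₁ + ind b i * ind b m)
  | Sum.inr (Sum.inr (Sum.inl i)) => (1 - ind P i) * (lam₁ + ind b i * (((P ∩ b).card : ℤ) - 1))
  | Sum.inr (Sum.inr (Sum.inr (Sum.inl (i, m)))) =>
      ind P i * (lam₂ - ind b i * ind b m - ind b i * max (((P ∩ b).card : ℤ) - 2) 0)
  | Sum.inr (Sum.inr (Sum.inr (Sum.inr (Sum.inl i)))) => ind P i * ind b i * max (((P ∩ b).card : ℤ) - 2) 0
  | Sum.inr (Sum.inr (Sum.inr (Sum.inr (Sum.inr i)))) => ind P i * ind b i * max (2 - ((P ∩ b).card : ℤ)) 0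

/-- asymmetric recourse: `(1 − |a∩b|)² + |a|·(λ₁|a∖P| + λ₂|P∖a|)` -/
def blindLHS₂ (lam₁ lam₂ : ℤ) (a b P : Finset (Fin n)) : ℤ :=
  (1 - ((a ∩ b).card : ℤ)) ^ 2 +
    a.card * (lam₁ * (a.card - ((a ∩ P).card : ℤ)) + lam₂ * (P.card - ((a ∩ P).card : ℤ)))


/-- column factors of the asymmetric identity are nonnegative once `λ₁ ≥ 1` and `λ₂ ≥ max(1, n − 1)`. -/
theorem blindCol₂_nonneg {lam₁ lam₂ : ℤ} (h1 : 1 ≤ lam₁) (h2 : 1 ≤ lam₂) (h2n : (n : ℤ) ≤ lam₂ + 1)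
    (b P : Finset (Fin n)) (idx : BIdx n) : 0 ≤ blindCol₂ lam₁ lam₂ b P idx := by
  have h0 := ind_nonneg (n := n); have h1' := ind_le_one (n := n)
  have hp : ((P ∩ b).card : ℤ) ≤ n := by
    have := Finset.card_le_univ (P ∩ b); rw [Fintype.card_fin] at this; exact_mod_cast this
  have hpc : (0 : ℤ) ≤ ((P ∩ b).card : ℤ) := Nat.cast_nonneg _
  rcases idx with k | ⟨i, m⟩ | i | ⟨i, m⟩ | i | i <;> simp only [blindCol₂]
  · split_ifs
    · norm_num
    · exact sq_nonneg _
  · exact mul_nonneg (by linarith [h1' P i]) (by nlinarith [h0 b i, h0 b m, h1' b i, h1' b m])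
  · exact mul_nonneg (by linarith [h1' P i]) (by nlinarith [mul_nonneg (h0 b i) hpc, h1' b i, h0 b i])
  · refine mul_nonneg (h0 P i) ?_
    rcases le_or_gt 2 ((P ∩ b).card : ℤ) with h | h
    · rw [max_eq_left (by linarith)]
      nlinarith [h0 b i, h1' b i, h0 b m, h1' b m, mul_nonneg (h0 b i) (h0 b m),
        mul_le_of_le_one_left (show (0:ℤ) ≤ ((P ∩ b).card : ℤ) - 2 by linarith) (h1' b i)]
    · rw [max_eq_right (by linarith)]
      nlinarith [h0 b i, h1' b i, h0 b m, h1' b m, mul_nonneg (h0 b i) (h0 b m)]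
  · exact mul_nonneg (mul_nonneg (h0 P i) (h0 b i)) (le_max_right _ _)
  · exact mul_nonneg (mul_nonneg (h0 P i) (h0 b i)) (le_max_right _ _)

/-- the symmetric column factors are the diagonal case `λ₁ = λ₂`. -/
theorem blindCol₂_self (lam : ℤ) (b P : Finset (Fin n)) (idx : BIdx n) :
    blindCol₂ lam lam b P idx = blindCol lam b P idx := by
  rcases idx with k | ⟨i, m⟩ | i | ⟨i, m⟩ | i | i <;> rfl

/-- ★ (rev 4) the ASYMMETRIC blindness identity, all `n`, all `λ₁, λ₂`: families A/B carry `λ₁` (the `a∖P` recourse), family C carries `λ₂` (the `P∖a` recourse). -/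
theorem blind_identity₂ (lam₁ lam₂ : ℤ) (a b P : Finset (Fin n)) :
    blindLHS₂ lam₁ lam₂ a b P = ∑ idx : BIdx n, blindRow a idx * blindCol₂ lam₁ lam₂ b P idx := by
  classical
  rw [sum_BIdx]
  simp only [blindRow, blindCol₂, Fin.isValue, if_true, show ((1 : Fin 2) = 0) = False from eq_false (by decide),
    if_false]
  -- notation
  have hX2 := ind_mul_self a
  have hY2 := ind_mul_self b
  have sX := sum_ind a
  have sP := sum_ind P
  have sXY := sum_ind_mul a b
  have sPY := sum_ind_mul P b
  have sXP := sum_ind_mul a P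
  set M1 : ℤ := max (((P ∩ b).card : ℤ) - 2) 0 with hM1
  set M3 : ℤ := max (2 - ((P ∩ b).card : ℤ)) 0 with hM3
  have hM : M3 = M1 + (2 - ((P ∩ b).card : ℤ)) := by
    rw [hM1, hM3]
    rcases le_total (((P ∩ b).card : ℤ)) 2 with h | h
    · rw [max_eq_left (by linarith), max_eq_right (by linarith)]; ring
    · rw [max_eq_right (by linarith), max_eq_left (by linarith)]; ring
  -- family 1 (X_i X_m, m ≠ i): closed form per i
  have F1 : ∀ i, ∑ m, (if i = m then 0 else ind a i * ind a m) * ((1 - ind P i) * (lam₁ + ind b i * ind b m)) =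
      ind a i * (1 - ind P i) * (lam₁ * ((a.card : ℤ) - 1) + ind b i * (((a ∩ b).card : ℤ) - 1)) := by
    intro i
    have : ∀ m, (if i = m then 0 else ind a i * ind a m) * ((1 - ind P i) * (lam₁ + ind b i * ind b m)) =
        if i = m then 0 else ind a i * ind a m * ((1 - ind P i) * (lam₁ + ind b i * ind b m)) := by
      intro m; split_ifs <;> ring
    simp_rw [this]
    rw [sum_ite_eq_sub, hX2, hY2]
    have hs : ∑ m, ind a i * ind a m * ((1 - ind P i) * (lam₁ + ind b i * ind b m)) =
        ind a i * (1 - ind P i) * (lam₁ * ∑ m, ind a m + ind b i * ∑ m, ind a m * ind b m) := by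
      rw [Finset.mul_sum, Finset.mul_sum, ← Finset.sum_add_distrib, Finset.mul_sum]
      exact Finset.sum_congr rfl fun m _ => by ring
    rw [hs, sX, sXY]; ring
  -- family 3 ((1−X_i) X_m, m ≠ i): closed form per i
  have F3 : ∀ i, ∑ m, (if i = m then 0 else (1 - ind a i) * ind a m) *
        (ind P i * (lam₂ - ind b i * ind b m - ind b i * M1)) =
      (1 - ind a i) * ind P i * (lam₂ * (a.card : ℤ) - ind b i * ((a ∩ b).card : ℤ) - ind b i * M1 * (a.card : ℤ)) := by
    intro i
    have : ∀ m, (if i = m then 0 else (1 - ind a i) * ind a m) * (ind P i * (lam₂ - ind b i * ind b m - ind b i * M1)) =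
        if i = m then 0 else (1 - ind a i) * ind a m * (ind P i * (lam₂ - ind b i * ind b m - ind b i * M1)) := by
      intro m; split_ifs <;> ring
    simp_rw [this]
    rw [sum_ite_eq_sub]
    have h0 : (1 - ind a i) * ind a i = 0 := by rw [sub_mul, one_mul, hX2, sub_self]
    have hs : ∑ m, (1 - ind a i) * ind a m * (ind P i * (lam₂ - ind b i * ind b m - ind b i * M1)) =
        (1 - ind a i) * ind P i * (lam₂ * ∑ m, ind a m - ind b i * ∑ m, ind a m * ind b m - ind b i * M1 * ∑ m, ind a m) := by
      rw [Finset.mul_sum, Finset.mul_sum, Finset.mul_sum, ← Finset.sum_sub_distrib, ← Finset.sum_sub_distrib, Finset.mul_sum]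
      exact Finset.sum_congr rfl fun m _ => by ring
    rw [hs, sX, sXY]
    have : (1 - ind a i) * ind a i * (ind P i * (lam₂ - ind b i * ind b i - ind b i * M1)) = 0 := by rw [h0, zero_mul]
    rw [this]; ring
  simp_rw [F1, F3]
  -- case split on a = ∅
  rcases eq_or_ne a ∅ with rfl | ha
  · simp [blindLHS₂, ind]
  · have hk : max ((a.card : ℤ) - 1) 0 = (a.card : ℤ) - 1 := by
      rw [max_eq_left]; have := Finset.card_pos.2 (Finset.nonempty_iff_ne_empty.2 ha); omega
    simp only [ha, if_false, hk, one_mul, zero_add, mul_one]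
    -- per-i regrouping
    have per : ∀ i,
        ind a i * (1 - ind P i) * (lam₁ * ((a.card : ℤ) - 1) + ind b i * (((a ∩ b).card : ℤ) - 1)) +
        (ind a i * ((1 - ind P i) * (lam₁ + ind b i * (((P ∩ b).card : ℤ) - 1))) +
        ((1 - ind a i) * ind P i * (lam₂ * (a.card : ℤ) - ind b i * ((a ∩ b).card : ℤ) - ind b i * M1 * (a.card : ℤ)) +
        ((1 - ind a i) * ((a.card : ℤ) - 1) * (ind P i * ind b i * M1) +
         (1 - ind a i) * (ind P i * ind b i * M3)))) =
        lam₁ * (a.card : ℤ) * ind a i + lam₂ * (a.card : ℤ) * ind P i - (lam₁ + lam₂) * (a.card : ℤ) * (ind a i * ind P i)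
          + (((a ∩ b).card : ℤ) + ((P ∩ b).card : ℤ) - 2) * (ind a i * ind b i)
          - (((a ∩ b).card : ℤ) + ((P ∩ b).card : ℤ) - 2) * (ind P i * ind b i) := by
      intro i
      rw [hM]
      ring
    rw [← Finset.sum_add_distrib, ← Finset.sum_add_distrib, ← Finset.sum_add_distrib, ← Finset.sum_add_distrib]
    rw [Finset.sum_congr rfl (fun i _ => per i)]
    rw [Finset.sum_sub_distrib, Finset.sum_add_distrib, Finset.sum_sub_distrib, Finset.sum_add_distrib,
      ← Finset.mul_sum, ← Finset.mul_sum, ← Finset.mul_sum, ← Finset.mul_sum, ← Finset.mul_sum,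
      sX, sP, sXP, sXY, sPY, blindLHS₂]
    ring


end IntCore

/-- the identity at `n = 3`, `λ = 2` (all `8³` triples, `29` slots) — now a one-line instance of `blind_identity`. -/
theorem blind_identity_three :
    ∀ a b P : Finset (Fin 3), blindLHS 2 a b P = ∑ idx : BIdx 3, blindRow a idx * blindCol 2 b P idx :=
  fun a b P => blind_identity 2 a b P

/-- the identity at `n = 4`, `λ = 3` (all `16³` triples, `46` slots). -/
theorem blind_identity_four :
    ∀ a b P : Finset (Fin 4), blindLHS 3 a b P = ∑ idx : BIdx 4, blindRow a idx * blindCol 3 b P idx :=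
  fun a b P => blind_identity 3 a b P

/-- ★★ **rank₊ of the augmented clique-row slack of `COR(n) + λ•Q♮` is at most `|BIdx n| = 2n² + 3n + 2`, ALL `n`**
(`2n` of the slots are identically zero, so `≤ 2n² + n + 2`): for every integer `λ ≥ max(1, n − 1)` there are
NONNEGATIVE `U : rows → BIdx n → ℝ`, `V : columns → BIdx n → ℝ` with `1 − ⟨udRow a, udPt b + λ q_P⟩ = Σ_idx U a idx · V (b,P) idx`. -/
theorem blindPair_factorization (n : ℕ) (lam : ℤ) (hlam1 : 1 ≤ lam) (hlam : (n : ℤ) ≤ lam + 1) :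
    ∃ (U : Finset (Fin n) → BIdx n → ℝ) (V : Finset (Fin n) × Finset (Fin n) → BIdx n → ℝ),
      (∀ a idx, 0 ≤ U a idx) ∧ (∀ c idx, 0 ≤ V c idx) ∧
      ∀ a b P : Finset (Fin n),
        1 - udRow a ⬝ᵥ (udPt b + (lam : ℝ) • qNat P) = ∑ idx, U a idx * V (b, P) idx := by
  refine ⟨fun a idx => (blindRow a idx : ℝ), fun c idx => (blindCol lam c.1 c.2 idx : ℝ),
    fun a idx => Int.cast_nonneg_iff.mpr (blindRow_nonneg a idx),
    fun c idx => Int.cast_nonneg_iff.mpr (blindCol_nonneg hlam1 hlam c.1 c.2 idx), fun a b P => ?_⟩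
  rw [blindPair_slack]
  have h' := congrArg (fun z : ℤ => (z : ℝ)) (blind_identity lam a b P)
  simp only [blindLHS] at h'
  push_cast at h'
  rw [← h']

/-- the `n = 4`, `λ = 3` instance (46 slots; kept under its rev-1 name). -/
theorem blindPair_factorization_four :
    ∃ (U : Finset (Fin 4) → BIdx 4 → ℝ) (V : Finset (Fin 4) × Finset (Fin 4) → BIdx 4 → ℝ),
      (∀ a idx, 0 ≤ U a idx) ∧ (∀ c idx, 0 ≤ V c idx) ∧
      ∀ a b P : Finset (Fin 4),
        1 - udRow a ⬝ᵥ (udPt b + (3 : ℝ) • qNat P) = ∑ idx, U a idx * V (b, P) idx := by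
  have h := blindPair_factorization 4 3 (by norm_num) (by norm_num)
  simpa using h

/-- the headline instance `λ = n` (`n ≥ 1`). -/
theorem blindPair_factorization_self (n : ℕ) (hn : 1 ≤ n) :
    ∃ (U : Finset (Fin n) → BIdx n → ℝ) (V : Finset (Fin n) × Finset (Fin n) → BIdx n → ℝ),
      (∀ a idx, 0 ≤ U a idx) ∧ (∀ c idx, 0 ≤ V c idx) ∧
      ∀ a b P : Finset (Fin n),
        1 - udRow a ⬝ᵥ (udPt b + (n : ℝ) • qNat P) = ∑ idx, U a idx * V (b, P) idx := by
  have h := blindPair_factorization n n (by exact_mod_cast hn) (by linarith)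
  simpa using h

/-- ★ (rev 4) **asymmetric blindness, ALL `n`**: for integers `λ₁ ≥ 1`, `λ₂ ≥ max(1, n−1)` the matrix
`(a;(b,P)) ↦ (1 − |a∩b|)² + |a|·(λ₁|a∖P| + λ₂|P∖a|)` has an explicit NONNEGATIVE factorization through `BIdx n`
(`rank₊ ≤ 2n² + n + 2`). Row-dependent weights above these floors add rank-one nonnegative terms only. -/
theorem asymBlind_factorization (n : ℕ) (lam₁ lam₂ : ℤ) (h1 : 1 ≤ lam₁) (h2 : 1 ≤ lam₂) (h2n : (n : ℤ) ≤ lam₂ + 1) :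
    ∃ (U : Finset (Fin n) → BIdx n → ℝ) (V : Finset (Fin n) × Finset (Fin n) → BIdx n → ℝ),
      (∀ a idx, 0 ≤ U a idx) ∧ (∀ c idx, 0 ≤ V c idx) ∧
      ∀ a b P : Finset (Fin n),
        (1 - ((a ∩ b).card : ℝ)) ^ 2 +
            (a.card : ℝ) * ((lam₁ : ℝ) * ((a \ P).card : ℝ) + (lam₂ : ℝ) * ((P \ a).card : ℝ)) =
          ∑ idx, U a idx * V (b, P) idx := by
  refine ⟨fun a idx => (blindRow a idx : ℝ), fun c idx => (blindCol₂ lam₁ lam₂ c.1 c.2 idx : ℝ),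
    fun a idx => Int.cast_nonneg_iff.mpr (blindRow_nonneg a idx),
    fun c idx => Int.cast_nonneg_iff.mpr (blindCol₂_nonneg h1 h2 h2n c.1 c.2 idx), fun a b P => ?_⟩
  have h' := congrArg (fun z : ℤ => (z : ℝ)) (blind_identity₂ lam₁ lam₂ a b P)
  simp only [blindLHS₂] at h'
  push_cast at h'
  rw [← h']
  have e1 : ((a \ P).card : ℝ) = (a.card : ℝ) - ((a ∩ P).card : ℝ) := by
    have h := Finset.card_sdiff_add_card_inter a P
    have h' : ((a \ P).card : ℝ) + ((a ∩ P).card : ℝ) = (a.card : ℝ) := by exact_mod_cast h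
    linarith
  have e2 : ((P \ a).card : ℝ) = (P.card : ℝ) - ((a ∩ P).card : ℝ) := by
    have h := Finset.card_sdiff_add_card_inter P a
    rw [Finset.inter_comm P a] at h
    have h' : ((P \ a).card : ℝ) + ((a ∩ P).card : ℝ) = (P.card : ℝ) := by exact_mod_cast h
    linarith
  rw [e1, e2]

/-! ## §3 Hardness of the same pair BY NAME — PROP B at the vertex pencil `S = {0}`, `S' = ∅`

`⟨E_00, q_P⟩ = 2·[0 ∈ P] − 1 − |P|` is maximised over the vertices of `Q♮` by `P = {0}` ALONE, so the tree theorem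
`corPolytope_add_face_three_pow_le'` (PROP B of `xc_division`, a LOCATED diagonal-face certificate) gives
`3^{n−1} ≤ (r + 1)·2^{n−1}` for every size-`r` extended formulation of `COR(n) + λ•Q♮` (`λ > 0`): the pair whose augmented
clique-row slack has nonnegative rank `≤ 2n² + n + 2` (§2) has extension complexity `≥ 1.5^{n−1} − 1`. -/

section Hard
variable {n : ℕ}

theorem flatDiag_dotProduct_udPt (σ : Fin n → ℝ) (b : Finset (Fin n)) :
    flat (Matrix.diagonal σ) ⬝ᵥ udPt b = ∑ i ∈ b, σ i := (ud_data n).2.2.2 σ b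

theorem flatDiag_dotProduct_flatDiag (σ τ : Fin n → ℝ) :
    flat (Matrix.diagonal σ) ⬝ᵥ flat (Matrix.diagonal τ) = ∑ i, σ i * τ i := by
  rw [flat_dotProduct_flat]
  refine Finset.sum_congr rfl fun i _ => ?_
  rw [Finset.sum_eq_single i]
  · rw [Matrix.diagonal_apply_eq, Matrix.diagonal_apply_eq]
  · intro j _ hji; rw [Matrix.diagonal_apply_ne _ (Ne.symm hji), zero_mul]
  · intro hi; exact absurd (Finset.mem_univ i) hi

theorem flatDiag_dotProduct_qNat (σ : Fin n → ℝ) (P : Finset (Fin n)) :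
    flat (Matrix.diagonal σ) ⬝ᵥ qNat P =
      ∑ i ∈ Pᶜ, σ i - ∑ i ∈ P, σ i + ∑ i, σ i * (4 * udInd P i - 2 - (P.card : ℝ)) := by
  rw [qNat, dotProduct_add, dotProduct_sub, flatDiag_dotProduct_udPt, flatDiag_dotProduct_udPt,
    flatDiag_dotProduct_flatDiag]

/-- the vertex pencil `E_00 = diagDir {0} ∅` reads `2·[0 ∈ P] − 1 − |P|` on `q_P`. -/
theorem diagDir_zero_dotProduct_qNat {k : ℕ} (P : Finset (Fin (k + 1))) :
    diagDir {0} ∅ ⬝ᵥ qNat P = 2 * udInd P 0 - 1 - (P.card : ℝ) := by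
  classical
  have hσ : (fun i : Fin (k + 1) =>
      if i ∈ ({0} : Finset (Fin (k + 1))) then (1 : ℝ) else if i ∈ (∅ : Finset (Fin (k + 1))) then -1 else 0) =
      fun i => if i = 0 then 1 else 0 := by
    funext i; simp [Finset.mem_singleton]
  rw [diagDir, hσ, flatDiag_dotProduct_qNat]
  rw [Finset.sum_ite_eq' Pᶜ (0 : Fin (k + 1)) (fun _ => (1 : ℝ)), Finset.sum_ite_eq' P (0 : Fin (k + 1)) (fun _ => (1 : ℝ))]
  simp only [ite_mul, one_mul, zero_mul, Finset.sum_ite_eq', Finset.mem_univ, if_true, Finset.mem_compl, udInd_apply]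
  by_cases h0 : (0 : Fin (k + 1)) ∈ P
  · simp only [h0, not_true_eq_false, if_false, if_true]; ring
  · simp only [h0, not_false_eq_true, if_true, if_false]; ring

/-- `P = {0}` is the UNIQUE maximiser of the vertex pencil over `Q♮`: value `0` there, `≤ −1` elsewhere. -/
theorem diagDir_zero_dotProduct_qNat_singleton {k : ℕ} :
    diagDir {0} ∅ ⬝ᵥ qNat ({0} : Finset (Fin (k + 1))) = 0 := by
  rw [diagDir_zero_dotProduct_qNat, udInd_apply, if_pos (Finset.mem_singleton_self _), Finset.card_singleton]
  norm_num

theorem diagDir_zero_dotProduct_qNat_le {k : ℕ} {P : Finset (Fin (k + 1))} (hP : P ≠ {0}) :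
    diagDir {0} ∅ ⬝ᵥ qNat P ≤ -1 := by
  classical
  rw [diagDir_zero_dotProduct_qNat, udInd_apply]
  by_cases h0 : (0 : Fin (k + 1)) ∈ P
  · rw [if_pos h0]
    have h2 : 2 ≤ P.card := by
      by_contra hlt
      have hle : P.card ≤ 1 := by omega
      rcases Finset.card_le_one.1 hle with h1
      apply hP
      ext i
      simp only [Finset.mem_singleton]
      exact ⟨fun hi => h1 i hi 0 h0, fun hi => hi ▸ h0⟩
    have : (2 : ℝ) ≤ P.card := by exact_mod_cast h2
    linarith
  · rw [if_neg h0]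
    have : (0 : ℝ) ≤ P.card := Nat.cast_nonneg _
    linarith

/-- ★ **hardness of the blind pair, BY NAME (PROP B):** every extended formulation of `COR(k+1) + λ•Q♮` has size
`r` with `3^k ≤ (r + 1)·2^k`, although the augmented clique-row slack of the same pair has nonnegative rank
`≤ 2(k+1)² + (k+1) + 2` (§2).  The certificate is LOCATED (the diagonal face `x_00 = 1` of `COR`). -/
theorem blindPair_hard {k r : ℕ} {lam : ℝ} (hlam : 0 < lam)
    (h : HasEFOfSize (corPolytope (k + 1) +
      convexHull ℝ (Set.range fun P : Finset (Fin (k + 1)) => lam • qNat P)) r) :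
    3 ^ k ≤ (r + 1) * 2 ^ k := by
  classical
  set q : Finset (Fin (k + 1)) → (Fin ((k + 1) * (k + 1)) → ℝ) := fun P => lam • qNat P with hq_def
  have hq : ∀ j, q j ∈ convexHull ℝ (Set.range q) := fun j => subset_convexHull ℝ _ (Set.mem_range_self j)
  obtain ⟨j₀, hmax, hcount⟩ :=
    corPolytope_add_face_three_pow_le' h q hq subset_rfl {0} ∅ (Finset.disjoint_empty_right _)
  have hval : ∀ P, diagDir {0} ∅ ⬝ᵥ q P = lam * (diagDir {0} ∅ ⬝ᵥ qNat P) := fun P => by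
    rw [hq_def]; simp only [dotProduct_smul, smul_eq_mul]
  -- the maximiser is `{0}`
  have hj₀ : j₀ = {0} := by
    by_contra hne
    have h1 := hmax {0}
    rw [hval, hval, diagDir_zero_dotProduct_qNat_singleton, mul_zero] at h1
    have h2 := diagDir_zero_dotProduct_qNat_le hne
    nlinarith
  -- and it is unique
  have e0 : diagDir {0} ∅ ⬝ᵥ q j₀ = 0 := by
    rw [hj₀, hval, diagDir_zero_dotProduct_qNat_singleton, mul_zero]
  have honly : ∀ P, diagDir {0} ∅ ⬝ᵥ q P = diagDir {0} ∅ ⬝ᵥ q j₀ → P = {0} := by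
    intro P hP
    rw [e0, hval] at hP
    by_contra hne
    have := diagDir_zero_dotProduct_qNat_le hne
    nlinarith
  have hsub : Fintype.card {j : Finset (Fin (k + 1)) // diagDir {0} ∅ ⬝ᵥ q j = diagDir {0} ∅ ⬝ᵥ q j₀} ≤ 1 :=
    Fintype.card_le_one_iff_subsingleton.mpr
      ⟨fun x y => Subtype.ext ((honly x.1 x.2).trans (honly y.1 y.2).symm)⟩
  have hk : k + 1 - (({0} : Finset (Fin (k + 1))).card + (∅ : Finset (Fin (k + 1))).card) = k := by
    rw [Finset.card_singleton, Finset.card_empty]; omega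
  rw [hk] at hcount
  calc 3 ^ k ≤ _ := hcount
    _ ≤ 1 * (r + 1) * 2 ^ k := by gcongr
    _ = (r + 1) * 2 ^ k := by ring

end Hard


/-! ## §4 Row-family laws (rev 3): the typed successor of the refuted clique-row law — LOCATION = TILT.

Yannakakis' factorization theorem (`HasEFOfSize.exists_nonneg_factorization`, tree) turns an EF of size `r` of
`COR(n) + Q` into an `(r+1)`-slot nonnegative factorization of the slack of ANY family of valid rows against the columns
`x_b + q_j`.  A ROW FAMILY `F` (rows `ρ a`, right-hand sides `β a` valid on `COR(n)`) therefore carries a LAW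
`F.Law`: «for every budgeted passenger the augmented `F`-row slack of `COR + Q` has no cheap nonnegative factorization»,
and EVERY such law implies COR-VIRTUAL (`corVirtualHardN_of_law`, PROVED; laws are monotone along embeddings of
families, `RowFamily.Law.mono`, PROVED).  The chain typed here:
`cliqueRows.Law` (= the realizable clique-row law P1 — REFUTED for all `n` by §2–§3 + the paper budget `xc(Q♮) ≤ 2n`)
`⟹ diagTilted.Law` (clique rows tilted by diagonal pencils `flat (diagonal σ)`: the family of PROP B's reads — `Q♮` is
NOT blind to it: the row `udRow a + μ•E₀₀`, `μ ≥ |a|(|a|+1)`, restricted to the face columns `(b ∋ 0, P = {0})` has slack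
`(1 − |a∩b|)²`, rank₊ `≥ 1.5^{n−1}`) `⟹ entryTilted.Law` (=: **C⁺ `LocatedPencilLaw`**: clique rows tilted by an arbitrary
matrix direction `flat W` with the box right-hand side `Σ max(W_im, 0)` — contains the switched-face reads `±E_im` of
`SwitchFace.lean`) `⟹ allRows.Law ⟹ CorVirtualHardN`.  The research question the card hands on (N14): is some BUDGETED
passenger blind to `diagTilted` (candidate `q^γ`) or even to `entryTilted`? -/
section RowFamilies
open Literature.Combinatorics.Optimization.FixedSizePsdRank (flat_dotProduct_le_of_mem_corPolytope)
open Summit.ValiantsHypothesis.ValiantsHypothesis.Cruxes.NNLinearDegreeCofactorHard.XcDivision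
  (T dot_le_of_mem_convexHull diag_valid)

/-- COR-VIRTUAL in the flat `corPolytope n` currency — VERBATIM `RecourseGraph.CorVirtualHardN` (val-idea-39 g2 workfile
`Cruxes/NNDivisionHard/RecourseGraph.lean` §3 @7e0b5a907a4c, where `corVirtualHard_of_matrixLaw`-style bridges connect it to the
line's graph currency); restated only because that module is not importable on the farm snapshot. -/
def CorVirtualHardN : Prop :=
  ∀ c : ℕ, ∃ n₀ : ℕ, ∀ n ≥ n₀, ∀ (K : ℕ) (q : Fin (K + 1) → (Fin (n * n) → ℝ)) (r : ℕ),
    HasEFOfSize (corPolytope n + convexHull ℝ (Set.range q)) r →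
      HasEFOfSize (convexHull ℝ (Set.range q)) r → T c n < r

/-- A ROW FAMILY for the correlation polytopes: index types `A n`, directions `ρ n a`, right-hand sides `β n a`
valid on `COR(n)`. -/
structure RowFamily where
  A : ℕ → Type
  ρ : ∀ n, A n → (Fin (n * n) → ℝ)
  β : ∀ n, A n → ℝ
  valid : ∀ n (a : A n), ∀ x ∈ corPolytope n, ρ n a ⬝ᵥ x ≤ β n a

/-- **THE `F`-ROW LAW.**  Eventually in `n`: for every passenger `Q = conv{q_j}` with an EF of size `r`, writing
`m a = max_j ⟨ρ a, q_j⟩`, if the augmented `F`-row slack `(β a + m a) − ⟨ρ a, x_b + q_j⟩` of `COR(n) + Q` has a nonnegative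
factorization through `r + 1` slots then `T c n < r`. -/
def RowFamily.Law (F : RowFamily) : Prop :=
  ∀ c : ℕ, ∃ n₀ : ℕ, ∀ n ≥ n₀, ∀ (K : ℕ) (q : Fin (K + 1) → (Fin (n * n) → ℝ)) (r : ℕ),
    HasEFOfSize (convexHull ℝ (Set.range q)) r →
    ∀ m : F.A n → ℝ, (∀ a j, F.ρ n a ⬝ᵥ q j ≤ m a) → (∀ a, ∃ j, F.ρ n a ⬝ᵥ q j = m a) →
    ∀ (U : F.A n → Option (Fin r) → ℝ) (V : Finset (Fin n) × Fin (K + 1) → Option (Fin r) → ℝ),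
      (∀ a i, 0 ≤ U a i) → (∀ p i, 0 ≤ V p i) →
      (∀ a b j, (F.β n a + m a) - F.ρ n a ⬝ᵥ (udPt b + q j) = ∑ i, U a i * V (b, j) i) → T c n < r

/-- ★ **EVERY ROW-FAMILY LAW IMPLIES COR-VIRTUAL** (Yannakakis' factorization theorem, once). -/
theorem corVirtualHardN_of_law (F : RowFamily) (hL : F.Law) : CorVirtualHardN := by
  classical
  intro c
  obtain ⟨n₀, hn₀⟩ := hL c
  refine ⟨n₀, fun n hn K q r hR hQ => ?_⟩
  obtain ⟨pt_mem, -, -, -⟩ := ud_data n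
  let m : F.A n → ℝ := fun a =>
    Finset.univ.sup' Finset.univ_nonempty (fun j : Fin (K + 1) => F.ρ n a ⬝ᵥ q j)
  have hmax : ∀ a, ∃ j, F.ρ n a ⬝ᵥ q j = m a := fun a => by
    obtain ⟨j, -, hj⟩ := Finset.exists_mem_eq_sup' Finset.univ_nonempty
      (fun j : Fin (K + 1) => F.ρ n a ⬝ᵥ q j)
    exact ⟨j, hj.symm⟩
  have hmq : ∀ a j, F.ρ n a ⬝ᵥ q j ≤ m a := fun a j =>
    Finset.le_sup' (fun j : Fin (K + 1) => F.ρ n a ⬝ᵥ q j) (Finset.mem_univ j)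
  have hm : ∀ a, ∀ y ∈ convexHull ℝ (Set.range q), F.ρ n a ⬝ᵥ y ≤ m a := fun a =>
    dot_le_of_mem_convexHull _ _ _ (by rintro _ ⟨j, rfl⟩; exact hmq a j)
  have hq : ∀ j, q j ∈ convexHull ℝ (Set.range q) := fun j => subset_convexHull ℝ _ ⟨j, rfl⟩
  have hv : ∀ p : Finset (Fin n) × Fin (K + 1),
      udPt p.1 + q p.2 ∈ corPolytope n + convexHull ℝ (Set.range q) :=
    fun p => Set.add_mem_add (pt_mem p.1) (hq p.2)
  have hvalid : ∀ a, ∀ x ∈ corPolytope n + convexHull ℝ (Set.range q), F.ρ n a ⬝ᵥ x ≤ F.β n a + m a := by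
    rintro a x ⟨p, hp, y, hy, rfl⟩
    rw [dotProduct_add]
    exact add_le_add (F.valid n a p hp) (hm a y hy)
  obtain ⟨U, V, hU, hV, hfac⟩ := Literature.Barriers.PneNP.HasEFOfSize.exists_nonneg_factorization hR
    (fun p : Finset (Fin n) × Fin (K + 1) => udPt p.1 + q p.2) hv (F.ρ n) (fun a => F.β n a + m a) hvalid
  exact hn₀ n hn K q r hQ m hmq hmax U V hU hV (fun a b j => hfac a (b, j))

/-- An EMBEDDING of row families: `G` contains (copies of) all rows of `F`. -/
structure RowFamily.Emb (F G : RowFamily) where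
  φ : ∀ n, F.A n → G.A n
  ρ_eq : ∀ n a, G.ρ n (φ n a) = F.ρ n a
  β_eq : ∀ n a, G.β n (φ n a) = F.β n a

/-- ★ **LAWS ARE MONOTONE**: a law for a SMALLER row family is a STRONGER statement (its factorizations are restrictions). -/
theorem RowFamily.Law.mono {F G : RowFamily} (e : RowFamily.Emb F G) (hF : F.Law) : G.Law := by
  intro c
  obtain ⟨n₀, hn₀⟩ := hF c
  refine ⟨n₀, fun n hn K q r hQ m hmq hmax U V hU hV hfac => ?_⟩
  refine hn₀ n hn K q r hQ (fun a => m (e.φ n a)) (fun a j => ?_) (fun a => ?_)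
    (fun a => U (e.φ n a)) V (fun a i => hU _ i) hV (fun a b j => ?_)
  · rw [← e.ρ_eq n a]; exact hmq _ j
  · obtain ⟨j, hj⟩ := hmax (e.φ n a); exact ⟨j, by rw [← e.ρ_eq n a]; exact hj⟩
  · rw [← e.ρ_eq n a, ← e.β_eq n a]; exact hfac _ b j

/-- the CLIQUE-ROW family `udRow a ≤ 1`.  Its law is the realizable clique-row law (the critic's retype P1) — REFUTED for
all `n` by §2–§3: on `Q = λ•Q♮` the augmented clique-row slack factors through `2n² + 3n + 2` slots (`blindPair_factorization`)
while `Q♮` is budgeted (`xc ≤ 2n`, affine image of a cube — paper) and `T c n ≥ 2n² + 3n + 2` eventually. -/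
@[reducible] def cliqueRows : RowFamily where
  A := fun n => Finset (Fin n)
  ρ := fun _ a => udRow a
  β := fun _ _ => 1
  valid := fun n a x hx => (ud_data n).2.1 a x hx

/-- the DIAGONALLY TILTED clique rows `udRow a + flat (diagonal σ) ≤ 1 + Σ_i max(σ_i, 0)` — the family of PROP B's
located reads (`diag_valid`).  `diagTilted.Law` =: C⁺_diag. -/
@[reducible] def diagTilted : RowFamily where
  A := fun n => Finset (Fin n) × (Fin n → ℝ)
  ρ := fun _ a => udRow a.1 + flat (Matrix.diagonal a.2)
  β := fun _ a => 1 + ∑ i, max (a.2 i) 0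
  valid := fun n a x hx => by
    rw [add_dotProduct]
    exact add_le_add ((ud_data n).2.1 a.1 x hx) (diag_valid n a.2 x hx)

/-- box validity: `⟨flat W, x⟩ ≤ Σ_{i,m} max(W_im, 0)` on `COR(n)`. -/
theorem flat_le_box {n : ℕ} (W : Matrix (Fin n) (Fin n) ℝ) :
    ∀ x ∈ corPolytope n, flat W ⬝ᵥ x ≤ ∑ i, ∑ m, max (W i m) 0 := by
  intro y hy
  refine flat_dotProduct_le_of_mem_corPolytope hy ⟨(W, ∑ i, ∑ m, max (W i m) 0), fun x hx => ?_⟩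
  refine Finset.sum_le_sum fun i _ => Finset.sum_le_sum fun m _ => ?_
  rcases hx i with hi | hi <;> rcases hx m with hm | hm <;> simp [hi, hm]

/-- ★ **C⁺ = `LocatedPencilLaw` := `entryTilted.Law`** — clique rows tilted by an ARBITRARY matrix direction with the box
right-hand side: `udRow a + flat W ≤ 1 + Σ max(W_im, 0)`.  Contains `diagTilted` (diagonal `W`) and the switched-face
reads `W = ±E_im` of `SwitchFace.lean`; strictly inside `allRows` (box right-hand sides only). -/
@[reducible] def entryTilted : RowFamily where
  A := fun n => Finset (Fin n) × Matrix (Fin n) (Fin n) ℝ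
  ρ := fun _ a => udRow a.1 + flat a.2
  β := fun _ a => 1 + ∑ i, ∑ m, max (a.2 i m) 0
  valid := fun n a x hx => by
    rw [add_dotProduct]
    exact add_le_add ((ud_data n).2.1 a.1 x hx) (flat_le_box a.2 x hx)

/-- ALL valid rows (its law is COR-VIRTUAL in Yannakakis form; only `⟹` is recorded here, via `corVirtualHardN_of_law`). -/
@[reducible] def allRows : RowFamily where
  A := fun n => {cd : (Fin (n * n) → ℝ) × ℝ // ∀ x ∈ corPolytope n, cd.1 ⬝ᵥ x ≤ cd.2}
  ρ := fun _ a => a.1.1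
  β := fun _ a => a.1.2
  valid := fun _ a => a.2

/-- `C⁺ := entryTilted.Law` under its card name. -/
def LocatedPencilLaw : Prop := entryTilted.Law

theorem flat_zero' {n : ℕ} : flat (0 : Matrix (Fin n) (Fin n) ℝ) = 0 := by
  funext ij; simp [flat]

/-- `cliqueRows ↪ diagTilted` (tilt `σ = 0`). -/
def cliqueRows_emb_diagTilted : RowFamily.Emb cliqueRows diagTilted where
  φ := fun n a => (a, 0)
  ρ_eq := fun n a => by
    show udRow a + flat (Matrix.diagonal fun _ : Fin n => (0 : ℝ)) = udRow a
    rw [Matrix.diagonal_zero, flat_zero', add_zero]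
  β_eq := fun n a => by
    show (1 : ℝ) + ∑ i : Fin n, max ((0 : Fin n → ℝ) i) 0 = 1
    simp

/-- `diagTilted ↪ entryTilted` (`W = diagonal σ`). -/
def diagTilted_emb_entryTilted : RowFamily.Emb diagTilted entryTilted where
  φ := fun n a => (a.1, Matrix.diagonal a.2)
  ρ_eq := fun _ _ => rfl
  β_eq := fun n a => by
    show (1 : ℝ) + ∑ i, ∑ m, max (Matrix.diagonal a.2 i m) 0 = 1 + ∑ i, max (a.2 i) 0
    congr 1
    refine Finset.sum_congr rfl fun i _ => ?_
    rw [Finset.sum_eq_single i (fun m _ hmi => by rw [Matrix.diagonal_apply_ne _ (Ne.symm hmi), max_self])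
      (fun h => absurd (Finset.mem_univ i) h), Matrix.diagonal_apply_eq]

/-- `entryTilted ↪ allRows`. -/
def entryTilted_emb_allRows : RowFamily.Emb entryTilted allRows where
  φ := fun n a => ⟨(entryTilted.ρ n a, entryTilted.β n a), entryTilted.valid n a⟩
  ρ_eq := fun _ _ => rfl
  β_eq := fun _ _ => rfl

/-- ★ the typed chain: `P1 ⟹ C⁺_diag ⟹ C⁺ ⟹ allRows.Law ⟹ COR-VIRTUAL` (all PROVED; P1 REFUTED; C⁺_diag, C⁺ OPEN). -/
theorem law_chain :
    (cliqueRows.Law → diagTilted.Law) ∧ (diagTilted.Law → LocatedPencilLaw) ∧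
      (LocatedPencilLaw → allRows.Law) ∧ (allRows.Law → CorVirtualHardN) :=
  ⟨RowFamily.Law.mono cliqueRows_emb_diagTilted, RowFamily.Law.mono diagTilted_emb_entryTilted,
    RowFamily.Law.mono entryTilted_emb_allRows, corVirtualHardN_of_law allRows⟩

/-- ★ **C⁺ ⟹ COR-VIRTUAL** (the bridge the card promised, PROVED). -/
theorem corVirtualHardN_of_locatedPencilLaw (h : LocatedPencilLaw) : CorVirtualHardN :=
  corVirtualHardN_of_law entryTilted h

end RowFamilies


/-! ## §5 (rev 5) Prices P-P1a / P-P1b of VERDICT #29 (crit-9 g1)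

* P-P1a `corVirtualHard_of_corVirtualHardN` — the flat-currency `CorVirtualHardN` implies COR-VIRTUAL in the GRAPH currency of
  the line of record (`XcDivision.VPLine.CorVirtualHard`, restated verbatim below because `Lines/virtual_passenger` is not yet in
  the farm build closure; `Iff.rfl` once it is), so `law_chain` ends one `nnDivisionHard_of_corVirtual` away from the crux decl.
* P-P1b `not_cliqueRowsLaw_of_budget` — the realizable clique-row law P1 is FALSE in the kernel, GIVEN the budget of `Q♮`
  as an explicit hypothesis (`xc(n•Q♮) ≤ 2n² + 3n + 1`); §6 below DISCHARGES the hypothesis (`cubeBudget_holds`), giving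
  `not_cliqueRowsLaw` unconditionally. -/

section Prices
open Summit.ValiantsHypothesis.ValiantsHypothesis.Cruxes.NNLinearDegreeCofactorHard.XcDivision (T)
open Literature.Barriers.PneNP (corPolytope_eq_image_corPolytopeGraph_top)
open Literature.Combinatorics.Optimization (corPolytopeGraph)

/-- **COR-VIRTUAL, graph currency** — verbatim `XcDivision.VPLine.CorVirtualHard` of `Lines/virtual_passenger.lean`. -/
def CorVirtualHard : Prop :=
  ∀ c : ℕ, ∃ h₀ : ℕ, ∀ h ≥ h₀, ∀ (K : ℕ) (q : Fin (K + 1) → (Fin h × Fin h → ℝ)) (r : ℕ),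
    HasEFOfSize (convexHull ℝ (Set.range q)) r →
    HasEFOfSize (corPolytopeGraph (⊤ : SimpleGraph (Fin h)) + convexHull ℝ (Set.range q)) r → T c h < r

/-- ★ P-P1a: flat currency ⇒ graph currency (the `funCongrLeft finProdFinEquiv` transport of g2's `RecourseGraph`, factored out). -/
theorem corVirtualHard_of_corVirtualHardN (hN : CorVirtualHardN) : CorVirtualHard := by
  intro c
  obtain ⟨h₀, hh₀⟩ := hN c
  refine ⟨h₀, fun h hh K q r hQ hR => ?_⟩
  let e : (Fin h × Fin h → ℝ) ≃ₗ[ℝ] (Fin (h * h) → ℝ) :=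
    LinearEquiv.funCongrLeft ℝ ℝ (finProdFinEquiv (m := h) (n := h)).symm
  have hQimg : e '' convexHull ℝ (Set.range q) = convexHull ℝ (Set.range (e ∘ q)) := by
    rw [Set.range_comp]; exact e.toLinearMap.image_convexHull (Set.range q)
  have himg : e '' (corPolytopeGraph (⊤ : SimpleGraph (Fin h)) + convexHull ℝ (Set.range q)) =
      corPolytope h + convexHull ℝ (Set.range (e ∘ q)) := by
    rw [Set.image_add, corPolytope_eq_image_corPolytopeGraph_top, hQimg]
  have hR' : HasEFOfSize (corPolytope h + convexHull ℝ (Set.range (e ∘ q))) r := by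
    rw [← himg]; exact (HasEFOfSize.image_linearEquiv_iff e).2 hR
  have hQ' : HasEFOfSize (convexHull ℝ (Set.range (e ∘ q))) r := by
    rw [← hQimg]; exact (HasEFOfSize.image_linearEquiv_iff e).2 hQ
  exact hh₀ h hh K (e ∘ q) r hR' hQ'

/-- the whole chain in graph currency: `LocatedPencilLaw → CorVirtualHard`. -/
theorem corVirtualHard_of_locatedPencilLaw (h : LocatedPencilLaw) : CorVirtualHard :=
  corVirtualHard_of_corVirtualHardN (corVirtualHardN_of_locatedPencilLaw h)

/-- the BUDGET of the blind cube: `xc(n•Q♮(n)) ≤ 2n² + 3n + 1` for `n ≥ 1` (true with room to spare — `Q♮` is an affine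
image of `[0,1]ⁿ`, `xc ≤ 2n` — but the tree has no unit-cube EF lemma yet, so it is carried as a hypothesis). -/
def CubeBudget : Prop :=
  ∀ n : ℕ, 1 ≤ n →
    HasEFOfSize (convexHull ℝ (Set.range (fun P : Finset (Fin n) => (n : ℝ) • qNat P))) (2 * n ^ 2 + 3 * n + 1)

/-- `2n² + 3n + 1 ≤ T 2 n = 2^{(log₂ n + 2)²}`. -/
theorem budget_le_T_two (n : ℕ) : 2 * n ^ 2 + 3 * n + 1 ≤ T 2 n := by
  have hlt : n < 2 ^ (Nat.log 2 n + 1) := Nat.lt_pow_succ_log_self (by norm_num) n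
  set L := Nat.log 2 n with hL
  have h1 : 2 * n ^ 2 + 3 * n + 1 ≤ 2 * (n + 1) ^ 2 := by nlinarith
  have h2 : (n + 1) ^ 2 ≤ (2 ^ (L + 1)) ^ 2 := Nat.pow_le_pow_left (by omega) 2
  have h3 : 2 * (2 ^ (L + 1)) ^ 2 = 2 ^ (2 * L + 3) := by ring
  have h4 : 2 ^ (2 * L + 3) ≤ 2 ^ ((L + 2) ^ 2) := Nat.pow_le_pow_right (by norm_num) (by nlinarith)
  have hT : T 2 n = 2 ^ ((L + 2) ^ 2) := rfl
  omega

/-- ★ P-P1b: **the realizable clique-row law is FALSE** (given the cube budget): at every `n ≥ max n₀ 1` the passenger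
`n•Q♮`, the columns `(b,P)`, the row maxima `m ≡ 0` (attained at `P = a`) and the explicit nonnegative factorization of
§2 through `2n² + 3n + 2 = |Option (Fin (2n²+3n+1))|` slots satisfy every hypothesis of `cliqueRows.Law` with `c = 2`,
while `T 2 n ≥ 2n² + 3n + 1 = r`. -/
theorem not_cliqueRowsLaw_of_budget (hB : CubeBudget) : ¬ cliqueRows.Law := by
  classical
  intro hL
  obtain ⟨n₀, hn₀⟩ := hL 2
  obtain ⟨n, hnn₀, hn1⟩ : ∃ n, n₀ ≤ n ∧ 1 ≤ n := ⟨max n₀ 1, le_max_left _ _, le_max_right _ _⟩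
  -- columns `Fin (K+1) ≃ Finset (Fin n)`
  have hK : Fintype.card (Finset (Fin n)) = (Fintype.card (Finset (Fin n)) - 1) + 1 :=
    (Nat.sub_add_cancel Fintype.card_pos).symm
  set K := Fintype.card (Finset (Fin n)) - 1 with hKdef
  let eC : Finset (Fin n) ≃ Fin (K + 1) := Fintype.equivFinOfCardEq hK
  let q : Fin (K + 1) → (Fin (n * n) → ℝ) := fun j => (n : ℝ) • qNat (eC.symm j)
  -- slots `BIdx n ≃ Option (Fin r)`
  have hcard : Fintype.card (BIdx n) = Fintype.card (Option (Fin (2 * n ^ 2 + 3 * n + 1))) := by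
    rw [card_BIdx, Fintype.card_option, Fintype.card_fin]
  let eS : BIdx n ≃ Option (Fin (2 * n ^ 2 + 3 * n + 1)) := Fintype.equivOfCardEq hcard
  have hrange : Set.range q = Set.range (fun P : Finset (Fin n) => (n : ℝ) • qNat P) := by
    ext x; constructor
    · rintro ⟨j, rfl⟩; exact ⟨eC.symm j, rfl⟩
    · rintro ⟨P, rfl⟩; exact ⟨eC P, by simp [q]⟩
  have hQ : HasEFOfSize (convexHull ℝ (Set.range q)) (2 * n ^ 2 + 3 * n + 1) := by
    rw [hrange]; exact hB n hn1
  obtain ⟨U, V, hU, hV, hfac⟩ := blindPair_factorization_self n hn1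
  have key := hn₀ n hnn₀ K q (2 * n ^ 2 + 3 * n + 1) hQ (fun _ => 0)
    (fun a j => by
      show udRow a ⬝ᵥ ((n : ℝ) • qNat (eC.symm j)) ≤ 0
      rw [dotProduct_smul, smul_eq_mul]
      exact mul_nonpos_of_nonneg_of_nonpos (Nat.cast_nonneg n) (udRow_dotProduct_qNat_nonpos a _))
    (fun a => ⟨eC a, by
      show udRow a ⬝ᵥ ((n : ℝ) • qNat (eC.symm (eC a))) = 0
      rw [Equiv.symm_apply_apply, dotProduct_smul, smul_eq_mul, udRow_dotProduct_qNat_self, mul_zero]⟩)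
    (fun a i => U a (eS.symm i)) (fun p i => V (p.1, eC.symm p.2) (eS.symm i))
    (fun a i => hU a _) (fun p i => hV _ _)
    (fun a b j => by
      show ((1 : ℝ) + 0) - udRow a ⬝ᵥ (udPt b + (n : ℝ) • qNat (eC.symm j)) =
        ∑ i, U a (eS.symm i) * V (b, eC.symm j) (eS.symm i)
      rw [add_zero, hfac a b (eC.symm j)]
      exact (Equiv.sum_comp eS.symm (fun idx => U a idx * V (b, eC.symm j) idx)).symm)
  have hle := budget_le_T_two n
  omega

end Prices


/-! ## §6 (rev 6) The cube budget PROVED: `cubeBudget_holds : CubeBudget`, hence `not_cliqueRowsLaw : ¬ cliqueRows.Law`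
unconditionally.  The unit cube `[0,1]ⁿ = conv{𝟙_P}` is the slack system `x_i − y_i = 0, x_i + y'_i = 1, y, y' ≥ 0`
(`hasEFOfSize_of_system`, size `n + n`), `conv{𝟙_P} = [0,1]ⁿ` is Mathlib's `convexHull_pi` + `segment_eq_Icc`, and
`n•Q♮` is its image under the affine map `y ↦ L y + v`, `(L y)_{im} = n(2y_i[i=m] − [i=m]Σ_j y_j − [i≠m](y_i + y_m))`,
`v_{im} = n(1 − 2[i=m])` (`HasEFOfSize.image_affine`, `AffineMap.image_convexHull`). -/

section CubeEF
open Literature.Barriers.PneNP (hasEFOfSize_of_system)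

/-- the unit cube `[0,1]ⁿ` as a set of functions. -/
def unitCube (n : ℕ) : Set (Fin n → ℝ) := Set.univ.pi fun _ => Set.Icc (0 : ℝ) 1

/-- ★ `xc([0,1]ⁿ) ≤ 2n`: the slack system `x_i − y_{inl i} = 0`, `x_i + y_{inr i} = 1`, `y ≥ 0`. -/
theorem hasEFOfSize_unitCube (n : ℕ) : HasEFOfSize (unitCube n) (n + n) := by
  classical
  let E : Matrix (Fin n ⊕ Fin n) (Fin n) ℝ := Matrix.of fun r i => if i = Sum.elim id id r then 1 else 0
  let F : Matrix (Fin n ⊕ Fin n) (Fin n ⊕ Fin n) ℝ :=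
    Matrix.of fun r s => if s = r then Sum.elim (fun _ => (-1 : ℝ)) (fun _ => 1) r else 0
  let g : Fin n ⊕ Fin n → ℝ := Sum.elim (fun _ => 0) (fun _ => 1)
  have hE : ∀ (x : Fin n → ℝ) r, (E *ᵥ x) r = x (Sum.elim id id r) := by
    intro x r
    simp only [Matrix.mulVec, dotProduct, E, Matrix.of_apply]
    rw [Finset.sum_eq_single (Sum.elim id id r)]
    · simp
    · intro i _ hi; simp [hi]
    · intro h; exact absurd (Finset.mem_univ _) h
  have hF : ∀ (y : Fin n ⊕ Fin n → ℝ) r, (F *ᵥ y) r = Sum.elim (fun _ => (-1 : ℝ)) (fun _ => 1) r * y r := by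
    intro y r
    simp only [Matrix.mulVec, dotProduct, F, Matrix.of_apply]
    rw [Finset.sum_eq_single r]
    · simp
    · intro s _ hs; simp [hs]
    · intro h; exact absurd (Finset.mem_univ _) h
  have hsys : unitCube n = {x | ∃ y : Fin n ⊕ Fin n → ℝ, (∀ j, 0 ≤ y j) ∧ E *ᵥ x + F *ᵥ y = g} := by
    ext x
    simp only [unitCube, Set.mem_univ_pi, Set.mem_Icc, Set.mem_setOf_eq]
    constructor
    · intro hx
      refine ⟨Sum.elim (fun i => x i) (fun i => 1 - x i), ?_, ?_⟩
      · rintro (i | i)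
        · simpa using (hx i).1
        · simpa using (hx i).2
      · funext r
        rw [Pi.add_apply, hE, hF]
        rcases r with i | i <;> simp [g]
    · rintro ⟨y, hy, hsys⟩ i
      have h1 := congrFun hsys (Sum.inl i)
      have h2 := congrFun hsys (Sum.inr i)
      rw [Pi.add_apply, hE, hF] at h1 h2
      simp only [Sum.elim_inl, Sum.elim_inr, id, g] at h1 h2
      constructor
      · linarith [hy (Sum.inl i)]
      · linarith [hy (Sum.inr i)]
  rw [hsys]
  have h := hasEFOfSize_of_system (ι := Fin n) E F g
  simpa [Fintype.card_sum, Fintype.card_fin] using h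

/-- `conv{𝟙_P : P ⊆ [n]} = [0,1]ⁿ`. -/
theorem convexHull_range_udInd (n : ℕ) :
    convexHull ℝ (Set.range (udInd : Finset (Fin n) → Fin n → ℝ)) = unitCube n := by
  classical
  have hr : Set.range (udInd : Finset (Fin n) → Fin n → ℝ) = Set.univ.pi fun _ => ({0, 1} : Set ℝ) := by
    ext x
    simp only [Set.mem_range, Set.mem_univ_pi, Set.mem_insert_iff, Set.mem_singleton_iff]
    constructor
    · rintro ⟨P, rfl⟩ i
      rw [udInd_apply]; split_ifs <;> simp
    · intro hx
      refine ⟨Finset.univ.filter fun i => x i = 1, funext fun i => ?_⟩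
      rw [udInd_apply]
      rcases hx i with h | h
      · rw [if_neg (by simp [h]), h]
      · rw [if_pos (by simp [h]), h]
  rw [hr, convexHull_pi, unitCube]
  congr 1; funext i
  rw [convexHull_pair, segment_eq_Icc (zero_le_one' ℝ)]

/-- the linear part of `P ↦ n•q_P`. -/
def qLin (n : ℕ) : (Fin n → ℝ) →ₗ[ℝ] (Fin (n * n) → ℝ) where
  toFun y p :=
    (n : ℝ) * (if (finProdFinEquiv.symm p).1 = (finProdFinEquiv.symm p).2
      then 2 * y (finProdFinEquiv.symm p).1 - ∑ j, y j
      else -(y (finProdFinEquiv.symm p).1) - y (finProdFinEquiv.symm p).2)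
  map_add' y z := by
    funext p
    simp only [Pi.add_apply, Finset.sum_add_distrib]
    split_ifs <;> ring
  map_smul' c y := by
    funext p
    simp only [Pi.smul_apply, smul_eq_mul, RingHom.id_apply, ← Finset.mul_sum]
    split_ifs <;> ring

/-- the constant part of `P ↦ n•q_P`. -/
def qConst (n : ℕ) : Fin (n * n) → ℝ := fun p =>
  if (finProdFinEquiv.symm p).1 = (finProdFinEquiv.symm p).2 then -(n : ℝ) else (n : ℝ)

theorem sum_udInd_univ {n : ℕ} (P : Finset (Fin n)) : ∑ j, udInd P j = (P.card : ℝ) := by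
  classical
  simp only [udInd_apply]
  rw [Finset.sum_boole, Finset.filter_mem_eq_inter, Finset.univ_inter]

/-- `n•q_P = L(𝟙_P) + v` entrywise. -/
theorem smul_qNat_eq_affine {n : ℕ} (P : Finset (Fin n)) :
    (n : ℝ) • qNat P = qLin n (udInd P) + qConst n := by
  classical
  funext p
  simp only [qNat, udPt, Pi.smul_apply, Pi.add_apply, Pi.sub_apply, smul_eq_mul, qLin, qConst, LinearMap.coe_mk,
    AddHom.coe_mk, Literature.Combinatorics.Optimization.FixedSizePsdRank.vecOuter,
    flat, Matrix.diagonal_apply, sum_udInd_univ]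
  have hc : ∀ i, udInd Pᶜ i = 1 - udInd P i := by
    intro i; rw [udInd_apply, udInd_apply]; by_cases h : i ∈ P <;> simp [h]
  rw [hc, hc]
  split_ifs with h
  · rw [h]; ring
  · ring

/-- ★ the cube budget holds: `xc(n•Q♮(n)) ≤ n + n ≤ 2n² + 3n + 1`. -/
theorem cubeBudget_holds : CubeBudget := by
  intro n hn
  have h1 := (hasEFOfSize_unitCube n).image_affine (qLin n) (qConst n)
  rw [← convexHull_range_udInd] at h1
  have himg : (fun x => qLin n x + qConst n) '' convexHull ℝ (Set.range (udInd : Finset (Fin n) → Fin n → ℝ)) =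
      convexHull ℝ (Set.range fun P : Finset (Fin n) => (n : ℝ) • qNat P) := by
    let f : (Fin n → ℝ) →ᵃ[ℝ] (Fin (n * n) → ℝ) := (qLin n).toAffineMap + AffineMap.const ℝ (Fin n → ℝ) (qConst n)
    have hf : (fun x => qLin n x + qConst n) = ⇑f := by funext x; simp [f]
    have hcomp : (⇑f ∘ udInd) = fun P : Finset (Fin n) => (n : ℝ) • qNat P := by
      funext P
      rw [Function.comp_apply, ← hf, smul_qNat_eq_affine]
    rw [hf, AffineMap.image_convexHull, ← Set.range_comp, hcomp]
  rw [himg] at h1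
  exact h1.of_le (by nlinarith)

/-- ★★ **the realizable clique-row law is FALSE**, unconditionally. -/
theorem not_cliqueRowsLaw : ¬ cliqueRows.Law :=
  not_cliqueRowsLaw_of_budget cubeBudget_holds

end CubeEF

end Summit.ValiantsHypothesis.ValiantsHypothesis.Cruxes.NNDivisionHard.CliqueRowBlind
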